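import Mathlib
import HarnessLib
import Summits.NavierStokesRegularity.NavierStokesRegularity.Theorems.HalfSpaceWindowDoorCirculationCarryingRigidityConeLiouville
import Summits.NavierStokesRegularity.NavierStokesRegularity.Theorems.HalfSpaceWindowDoorCirculationCarryingRigidityFarConeSweeping
import Summits.NavierStokesRegularity.NavierStokesRegularity.Theorems.HalfSpaceWindowDoorCirculationCarryingRigidityFarConeRigidity
import Summits.NavierStokesRegularity.NavierStokesRegularity.Theorems.AxisTwistDoorAveragedConeLiouvilleCircleLimits

/-!
# Route `HalfSpaceWindowDoor`, crux `CirculationCarryingRigidity` (stmt-NavierStokesRegularity-25311) —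
# line `cone_sweep`, FAR-FIELD form, Step 4: a circle cone on FAR circles about ONE axis already forces `v ≡ 0`

LEAD ns-hsw-p1 g9, `--supports stmt-NavierStokesRegularity-25311 --as helper`; card `Cruxes/…/Lines/cone_sweep.md`.  Generalisation of
`…ConeLiouville.eq_zero_of_coned` (p683554).

**Theorem (`eq_zero_of_farConed`).**  A door-class profile (`‖v(s)‖_∞ ≤ C/√(−s)`, continuity, Oseen–Duhamel, divergence-free) with
`⟪curl v, e₃⟫ ≥ 0` satisfying the CIRCLE-AVERAGED cone `∮_{S(r,z)}|ω_h| dl ≤ K∮_{S(r,z)}ω₃ dl` on every circle about the `e₃`-axis of radius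
`r ≥ R₀√(−s)` (any `C`, `K ≥ 0`, `R₀ ≥ 0`) vanishes identically.  Inside the parabolic tube `{r < R₀√(−s)}` NOTHING is assumed.
Proof as in p683554 with the far-field files `…FarConeSweeping` (p684227) / `…FarConeRigidity`: the hypothesis is invariant under the
Navier–Stokes zooms about axis points (`vortCirc_zoom_axis`, `tiltCirc_zoom_axis`) and closed under F3 limits (`tendsto_vortCirc/tiltCirc`);
`S₀ = sup Γ` finite; `S₀ = 0` ⇒ saturation by the disc of radius `R₀ + 1` ⇒ `v ≡ 0`; `S₀ > 0` ⇒ extracted limit with a saturated disc of radius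
`R₁ ≥ R₀ + 1` ⇒ limit vanishes ⇒ contradiction.  Contains: the pointwise cone (p683554), the TUBE-CONE (cone only outside a parabolic tube about
one axis), and AxisTwistDoor's `GlobalCone` form in the TIME-ONLY class (no energy hypothesis; cf. `averagedConeLiouville_holds`).
CENSUS READING: the enemy of W6 violates EVERY cone on far circles about EVERY axis at some times.
WHAT THIS IS NOT: not about NS regularity; HYPOTHETICAL profiles; `HemisphereLiouvilleE3` (no cone at all) stays OPEN.  No item is closed.
-/

noncomputable section

-- the summit and its single sub-problem share the name (CONVENTIONS §1), as in every Theorems file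
set_option linter.dupNamespace false

namespace Summit.NavierStokesRegularity.NavierStokesRegularity.Theorems.HalfSpaceWindowDoorCirculationCarryingRigidityFarConeLiouville

open MeasureTheory Set Function Filter Topology InnerProductSpace
open scoped RealInnerProductSpace InnerProductSpace
open Literature.Analysis Literature.Analysis.FluidPDE Literature.Analysis.UnboundedOperators
open Summit.NavierStokesRegularity.NavierStokesRegularity.Theses.HalfSpaceWindowDoor
open Summit.NavierStokesRegularity.NavierStokesRegularity.Theorems.HalfSpaceWindowDoorCirculationCarryingRigidityDefs
  (InDoorClass SignE3 e3)
open Summit.NavierStokesRegularity.NavierStokesRegularity.Theorems.AxisTwistDoorAveragedConeLiouvilleDefs (cylPt eT circ vortCirc tiltCirc)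
open Summit.NavierStokesRegularity.NavierStokesRegularity.Theorems.AveragedConeLiouville.CircleStokes (inner_e3)
open Summit.NavierStokesRegularity.NavierStokesRegularity.Theorems.AveragedConeLiouville.CircMonotone (circ_zero)
open Summit.NavierStokesRegularity.NavierStokesRegularity.Theorems.AveragedConeLiouville.CircleLimits
  (tendsto_circ tendsto_vortCirc tendsto_tiltCirc tiltCirc_le_of_tendsto tendstoLocallyUniformly_curl)
open Summit.NavierStokesRegularity.NavierStokesRegularity.Theorems
  (exists_tendsto_of_isTypeIAncientMild_seq isTypeIAncientMild_zoom zoom_apply)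
open Summit.NavierStokesRegularity.NavierStokesRegularity.Theorems.HalfSpaceWindowDoorCirculationCarryingRigidityGaussKernel (inner_e3_apply)
open Summit.NavierStokesRegularity.NavierStokesRegularity.Theorems.HalfSpaceWindowDoorCirculationCarryingRigidityGaussExtremal
  (inDoorClass_of_isTypeIAncientMild)
open Summit.NavierStokesRegularity.NavierStokesRegularity.Theorems.HalfSpaceWindowDoorCirculationCarryingRigidityHorizontalVorticityFloor
  (tendsto_curl_of_tendsto_fderiv eq_zero_of_curl_parallel_slice)
open Summit.NavierStokesRegularity.NavierStokesRegularity.Theorems.PoloidalWindowDoorPoloidalWindowRigidityWindow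
  (isTypeIAncientMild_of_class)
open Summit.NavierStokesRegularity.NavierStokesRegularity.Theorems.HalfSpaceWindowDoorCirculationCarryingRigidityConeFluxSubsolution
  (signE3_atd contDiff_one_slice tube_bddAbove)
open Summit.NavierStokesRegularity.NavierStokesRegularity.Theorems.HalfSpaceWindowDoorCirculationCarryingRigidityFarConeSweeping
  (circ_le_sSup_of_farCone circ_le_const_of_farCone)
open Summit.NavierStokesRegularity.NavierStokesRegularity.Theorems.HalfSpaceWindowDoorCirculationCarryingRigidityFarConeRigidity
  (eq_zero_of_saturated_far)
open Summit.NavierStokesRegularity.NavierStokesRegularity.Theorems.HalfSpaceWindowDoorCirculationCarryingRigidityConeLiouville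
  (axisPt_add_smul_cylPt circ_zoom_axis circ_eq_zero_of_slice_zero)

variable {C : ℝ} {v : ℝ → EuclideanSpace ℝ (Fin 3) → EuclideanSpace ℝ (Fin 3)}

/-! ### The circle cone under zooms about axis points -/

/-- `∮ω₃ dl` under the zoom about `(0,0,ζ)`: `vortCirc[c • v(c²·,(0,0,ζ)+c·)](r,z,s) = c·vortCirc[v](c r, ζ + c z, c² s)`. -/
theorem vortCirc_zoom_axis (c ζ : ℝ) (u : ℝ → EuclideanSpace ℝ (Fin 3) → EuclideanSpace ℝ (Fin 3)) (r z s : ℝ) :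
    vortCirc (c • stPull (c ^ 2) c 0 (cylPt 0 0 ζ) u) r z s = c * vortCirc u (c * r) (ζ + c * z) (c ^ 2 * s) := by
  unfold vortCirc
  rw [← intervalIntegral.integral_const_mul]
  refine intervalIntegral.integral_congr fun θ _ => ?_
  simp only [curl_smul_stPull, zero_add, axisPt_add_smul_cylPt, inner_smul_left, RCLike.conj_to_real]
  ring

/-- `∮|ω_h| dl` under the zoom about `(0,0,ζ)`: `tiltCirc[c • v(c²·,(0,0,ζ)+c·)](r,z,s) = c·tiltCirc[v](c r, ζ + c z, c² s)`. -/
theorem tiltCirc_zoom_axis (c ζ : ℝ) (u : ℝ → EuclideanSpace ℝ (Fin 3) → EuclideanSpace ℝ (Fin 3)) (r z s : ℝ) :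
    tiltCirc (c • stPull (c ^ 2) c 0 (cylPt 0 0 ζ) u) r z s = c * tiltCirc u (c * r) (ζ + c * z) (c ^ 2 * s) := by
  unfold tiltCirc
  rw [← intervalIntegral.integral_const_mul]
  refine intervalIntegral.integral_congr fun θ _ => ?_
  simp only [curl_smul_stPull, zero_add, axisPt_add_smul_cylPt, inner_smul_left, RCLike.conj_to_real]
  rw [show (c * c) • curl (u (c ^ 2 * s)) (cylPt (c * r) θ (ζ + c * z))
        - (c * c * ⟪curl (u (c ^ 2 * s)) (cylPt (c * r) θ (ζ + c * z)),
            Summit.NavierStokesRegularity.NavierStokesRegularity.Theorems.AxisTwistDoorAveragedConeLiouvilleDefs.e3⟫_ℝ) •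
          Summit.NavierStokesRegularity.NavierStokesRegularity.Theorems.AxisTwistDoorAveragedConeLiouvilleDefs.e3
      = (c * c) • (curl (u (c ^ 2 * s)) (cylPt (c * r) θ (ζ + c * z))
        - ⟪curl (u (c ^ 2 * s)) (cylPt (c * r) θ (ζ + c * z)),
            Summit.NavierStokesRegularity.NavierStokesRegularity.Theorems.AxisTwistDoorAveragedConeLiouvilleDefs.e3⟫_ℝ •
          Summit.NavierStokesRegularity.NavierStokesRegularity.Theorems.AxisTwistDoorAveragedConeLiouvilleDefs.e3) by
      rw [smul_sub, smul_smul],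
    norm_smul, Real.norm_eq_abs, abs_of_nonneg (mul_self_nonneg c)]
  ring

/-- The far-field circle cone is invariant under the zooms about axis points (`c > 0`). -/
theorem farCone_zoom {K R₀ : ℝ} {u : ℝ → EuclideanSpace ℝ (Fin 3) → EuclideanSpace ℝ (Fin 3)}
    (hu : ∀ s < 0, ∀ r : ℝ, R₀ * Real.sqrt (-s) ≤ r → ∀ z : ℝ, tiltCirc u r z s ≤ K * vortCirc u r z s)
    {c : ℝ} (hc : 0 < c) (ζ : ℝ) :
    ∀ s < 0, ∀ r : ℝ, R₀ * Real.sqrt (-s) ≤ r → ∀ z : ℝ,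
      tiltCirc (c • stPull (c ^ 2) c 0 (cylPt 0 0 ζ) u) r z s ≤ K * vortCirc (c • stPull (c ^ 2) c 0 (cylPt 0 0 ζ) u) r z s := by
  intro s hs r hr z
  rw [tiltCirc_zoom_axis, vortCirc_zoom_axis]
  have hs' : c ^ 2 * s < 0 := mul_neg_of_pos_of_neg (pow_pos hc 2) hs
  have hr' : R₀ * Real.sqrt (-(c ^ 2 * s)) ≤ c * r := by
    rw [show -(c ^ 2 * s) = c ^ 2 * (-s) by ring, Real.sqrt_mul' _ (neg_pos.2 hs).le, Real.sqrt_sq hc.le]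
    nlinarith [hr, hc]
  have h := hu _ hs' _ hr' (ζ + c * z)
  nlinarith [h, hc]

/-! ### The theorem -/

/-- **THE CONE STRATUM IS DEAD (all `C`, `K`).**  A closed-hemisphere door-class profile whose vorticity lies everywhere in the cone
`‖ω_h‖ ≤ K·ω₃` vanishes identically. -/
theorem eq_zero_of_farConed (hv : InDoorClass C v) (hsign : SignE3 v) {K : ℝ} (hK : 0 ≤ K)
    {R₀ : ℝ} (hR₀ : 0 ≤ R₀) (hcone : ∀ s < 0, ∀ r : ℝ, R₀ * Real.sqrt (-s) ≤ r → ∀ z : ℝ, tiltCirc v r z s ≤ K * vortCirc v r z s) :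
    ∀ t < 0, ∀ x, v t x = 0 := by
  have hA : IsTypeIAncientMild C v := isTypeIAncientMild_of_class hv.1 hv.2.1 hv.2.2.1 hv.2.2.2
  set R₁ : ℝ := 4 * (C * (1 + K)) + R₀ + 1 with hR₁
  have hC : 0 ≤ C := hA.nonneg
  have hR₁0 : 0 ≤ R₁ := by positivity
  -- the total set of circulations and its supremum `S₀`
  set Tot : Set ℝ := {m | ∃ s : ℝ, s < 0 ∧ ∃ r : ℝ, 0 ≤ r ∧ ∃ z : ℝ, m = circ v r z s} with hTot
  have hTotle : ∀ m ∈ Tot, m ≤ 2 * Real.pi * (R₁ * C) := by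
    rintro m ⟨s, hs, r, hr, z, rfl⟩
    exact circ_le_const_of_farCone hv hsign hK hR₀ hcone hs hr z
  have hTotbdd : BddAbove Tot := ⟨_, hTotle⟩
  have hmem : ∀ s < 0, ∀ r : ℝ, 0 ≤ r → ∀ z, circ v r z s ∈ Tot := fun s hs r hr z => ⟨s, hs, r, hr, z, rfl⟩
  have hTotne : Tot.Nonempty := ⟨_, hmem (-1) (by norm_num) 0 le_rfl 0⟩
  set S₀ : ℝ := sSup Tot with hS₀
  have hleS : ∀ s < 0, ∀ r : ℝ, 0 ≤ r → ∀ z, circ v r z s ≤ S₀ := fun s hs r hr z => le_csSup hTotbdd (hmem s hs r hr z)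
  have hm1 : (-1 : ℝ) < 0 := by norm_num
  have hcone1 : ∀ r : ℝ, R₀ ≤ r → ∀ z : ℝ, tiltCirc v r z (-1) ≤ K * vortCirc v r z (-1) := fun r hr z =>
    hcone (-1) hm1 r (by rw [neg_neg, Real.sqrt_one, mul_one]; exact hr) z
  rcases le_or_gt S₀ 0 with hS | hS
  · -- every slice is saturated by the disc of radius `R₀ + 1`
    have h0 : circ v (R₀ + 1) 0 (-1) = 0 := le_antisymm ((hleS (-1) hm1 (R₀ + 1) (by positivity) 0).trans hS)
      (Summit.NavierStokesRegularity.NavierStokesRegularity.Theorems.AveragedConeLiouville.CircMonotone.circ_nonneg v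
        (contDiff_one_slice hv hm1) (signE3_atd hsign) hm1 (by positivity) 0)
    exact eq_zero_of_saturated_far hv hsign hK hm1 hR₀ hcone1 (R := R₀ + 1) (z₀ := 0) (S := 0) (by linarith) h0
      fun r hr z => (hleS (-1) hm1 r hr z).trans hS
  -- `S₀ > 0`: near-maximal TUBE-BOUNDARY discs at some `(s_n, z_n)`
  exfalso
  have hnear : ∀ n : ℕ, ∃ p : ℝ × ℝ, p.1 < 0 ∧ S₀ - 1 / ((n : ℝ) + 1) < circ v (R₁ * Real.sqrt (-p.1)) p.2 p.1 := by
    intro n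
    have hε : S₀ - 1 / ((n : ℝ) + 1) < S₀ := by
      have : (0 : ℝ) < 1 / ((n : ℝ) + 1) := by positivity
      linarith
    obtain ⟨m, ⟨s, hs, r, hr, z, rfl⟩, hm⟩ := exists_lt_of_lt_csSup hTotne hε
    -- the sweeping lemma at `s₁ = s`
    have hsw := circ_le_sSup_of_farCone hv hsign hK hR₀ hcone hs le_rfl hr z
    obtain ⟨hTbdd, -⟩ := tube_bddAbove hv hR₁0 hs
    have hTne : {m' : ℝ | ∃ s' : ℝ, s' ≤ s ∧ ∃ z' : ℝ, m' = circ v (R₁ * Real.sqrt (-s')) z' s'}.Nonempty :=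
      ⟨_, s, le_rfl, 0, rfl⟩
    obtain ⟨m', ⟨s', hs', z', rfl⟩, hm'⟩ := exists_lt_of_lt_csSup hTne (lt_of_lt_of_le hm hsw)
    exact ⟨(s', z'), lt_of_le_of_lt hs' hs, hm'⟩
  choose p hp1 hp2 using hnear
  set sn : ℕ → ℝ := fun n => (p n).1 with hsn
  set zn : ℕ → ℝ := fun n => (p n).2 with hzn
  set lam : ℕ → ℝ := fun n => Real.sqrt (-sn n) with hlam
  have hlam0 : ∀ n, 0 < lam n := fun n => Real.sqrt_pos.2 (neg_pos.2 (hp1 n))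
  have hlam2 : ∀ n, lam n ^ 2 = -sn n := fun n => Real.sq_sqrt (neg_pos.2 (hp1 n)).le
  -- the zooms about `(0,0,z_n)` with factor `λ_n = √(−s_n)`
  set w : ℕ → ℝ → EuclideanSpace ℝ (Fin 3) → EuclideanSpace ℝ (Fin 3) :=
    fun n => lam n • stPull (lam n ^ 2) (lam n) 0 (cylPt 0 0 (zn n)) v with hw
  have hwcl : ∀ n, IsTypeIAncientMild C (w n) := fun n => isTypeIAncientMild_zoom hA (hlam0 n) _
  have hwcirc : ∀ n r z s, circ (w n) r z s = circ v (lam n * r) (zn n + lam n * z) (lam n ^ 2 * s) := fun n r z s =>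
    circ_zoom_axis (lam n) (zn n) v r z s
  have hwR₁ : ∀ n, circ (w n) R₁ 0 (-1) = circ v (R₁ * Real.sqrt (-sn n)) (zn n) (sn n) := by
    intro n
    rw [hwcirc, mul_zero, add_zero, hlam2, mul_comm (lam n) R₁]
    congr 1
    ring
  have hwle : ∀ n, ∀ σ < 0, ∀ r : ℝ, 0 ≤ r → ∀ z, circ (w n) r z σ ≤ S₀ := by
    intro n σ hσ r hr z
    rw [hwcirc]
    refine hleS _ ?_ _ (mul_nonneg (hlam0 n).le hr) _
    exact mul_neg_of_pos_of_neg (pow_pos (hlam0 n) 2) hσ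
  have hwsign : ∀ n, SignE3 (w n) := by
    intro n σ hσ y
    have hcurl : curl (w n σ) y =
        (lam n * lam n) • curl (v (0 + lam n ^ 2 * σ)) (cylPt 0 0 (zn n) + lam n • y) :=
      curl_smul_stPull (lam n) (lam n ^ 2) (lam n) 0 (cylPt 0 0 (zn n)) v σ y
    rw [hcurl, real_inner_smul_left]
    refine mul_nonneg (mul_self_nonneg _) (hsign _ ?_ _)
    rw [zero_add]; exact mul_neg_of_pos_of_neg (pow_pos (hlam0 n) 2) hσ
  have hwcone : ∀ n, ∀ s < 0, ∀ r : ℝ, R₀ * Real.sqrt (-s) ≤ r → ∀ z : ℝ, tiltCirc (w n) r z s ≤ K * vortCirc (w n) r z s :=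
    fun n => farCone_zoom hcone (hlam0 n) _
  -- compactness
  obtain ⟨φ, hφ, W, hW, hpt, hptG, hlu, hluG⟩ := exists_tendsto_of_isTypeIAncientMild_seq C hwcl
  have hWdoor : InDoorClass C W := inDoorClass_of_isTypeIAncientMild hW
  have hWsign : SignE3 W := by
    intro σ hσ y
    have hc : Tendsto (fun j => ⟪curl (w (φ j) σ) y, e3⟫) atTop (𝓝 ⟪curl (W σ) y, e3⟫) :=
      (tendsto_curl_of_tendsto_fderiv (hptG σ hσ y)).inner tendsto_const_nhds
    exact ge_of_tendsto' hc fun j => hwsign (φ j) σ hσ y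
  have hcurlc : ∀ (u : ℝ → EuclideanSpace ℝ (Fin 3) → EuclideanSpace ℝ (Fin 3)), IsTypeIAncientMild C u → ∀ σ < 0,
      Continuous (curl (u σ)) := by
    intro u hu σ hσ
    have h1 : ContDiff ℝ 1 (u σ) := (hu.contDiff_slice hσ).of_le (by norm_cast)
    have hD : Continuous (fderiv ℝ (u σ)) := h1.continuous_fderiv one_ne_zero
    have e : curl (u σ) = fun x => curlCLM (fderiv ℝ (u σ) x) := by funext x; exact curl_eq_curlCLM (u σ) x
    rw [e]; exact curlCLM.continuous.comp hD
  have hWcone1 : ∀ r : ℝ, R₀ ≤ r → ∀ z : ℝ, tiltCirc W r z (-1) ≤ K * vortCirc W r z (-1) := by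
    intro r hr z
    have hm1' : (-1 : ℝ) < 0 := by norm_num
    have hcu := tendstoLocallyUniformly_curl (hluG (-1) hm1')
    refine tiltCirc_le_of_tendsto
      (tendsto_vortCirc (fun j => hcurlc _ (hwcl (φ j)) (-1) hm1') (hcurlc _ hW (-1) hm1') hcu r z)
      (tendsto_tiltCirc (fun j => hcurlc _ (hwcl (φ j)) (-1) hm1') (hcurlc _ hW (-1) hm1') hcu r z) fun j => ?_
    exact hwcone (φ j) (-1) hm1' r (by rw [neg_neg, Real.sqrt_one, mul_one]; exact hr) z
  have hclim : ∀ σ < 0, ∀ r z, Tendsto (fun j => circ (w (φ j)) r z σ) atTop (𝓝 (circ W r z σ)) := fun σ hσ r z =>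
    tendsto_circ (fun j => (hwcl (φ j)).continuous_slice hσ) (hW.continuous_slice hσ) (hlu σ hσ) r z
  -- the saturated disc of the limit
  have hWR₁ : circ W R₁ 0 (-1) = S₀ := by
    refine tendsto_nhds_unique (hclim (-1) hm1 R₁ 0) ?_
    have hlow : Tendsto (fun j => S₀ - 1 / ((φ j : ℝ) + 1)) atTop (𝓝 S₀) := by
      have h1 : Tendsto (fun j => 1 / ((φ j : ℝ) + 1)) atTop (𝓝 0) := by
        have hφ' : Tendsto (fun j => ((φ j : ℕ) : ℝ)) atTop atTop :=
          tendsto_natCast_atTop_atTop.comp hφ.tendsto_atTop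
        have : Tendsto (fun j => ((φ j : ℝ) + 1)) atTop atTop := tendsto_atTop_add_const_right _ 1 hφ'
        exact tendsto_const_nhds.div_atTop this
      simpa using tendsto_const_nhds.sub h1
    refine tendsto_of_tendsto_of_tendsto_of_le_of_le hlow tendsto_const_nhds (fun j => ?_) fun j => ?_
    · rw [hwR₁]; exact (hp2 (φ j)).le
    · exact hwle (φ j) (-1) hm1 R₁ hR₁0 0
  have hWle : ∀ r : ℝ, 0 ≤ r → ∀ z, circ W r z (-1) ≤ S₀ := fun r hr z =>
    le_of_tendsto' (hclim (-1) hm1 r z) fun j => hwle (φ j) (-1) hm1 r hr z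
  have hR₀R₁ : R₀ ≤ R₁ := by rw [hR₁]; nlinarith [hC, hK]
  have hW0 := eq_zero_of_saturated_far hWdoor hWsign hK hm1 hR₀ hWcone1 hR₀R₁ hWR₁ hWle
  have : circ W R₁ 0 (-1) = 0 := circ_eq_zero_of_slice_zero (hW0 (-1) hm1) R₁ 0
  linarith

/-- **Poloidality of the cone stratum** (the `HemisphereLiouvilleE3` conclusion for coned profiles, all `C`, `K`). -/
theorem inner_curl_e3_eq_zero_of_farConed (hv : InDoorClass C v) (hsign : SignE3 v) {K : ℝ} (hK : 0 ≤ K)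
    {R₀ : ℝ} (hR₀ : 0 ≤ R₀) (hcone : ∀ s < 0, ∀ r : ℝ, R₀ * Real.sqrt (-s) ≤ r → ∀ z : ℝ, tiltCirc v r z s ≤ K * vortCirc v r z s) :
    ∀ s < 0, ∀ y, ⟪curl (v s) y, e3⟫ = 0 := by
  intro s hs y
  have h0 := eq_zero_of_farConed hv hsign hK hR₀ hcone
  have hslice : v s = fun _ => 0 := funext fun x => h0 s hs x
  rw [inner_e3_apply, hslice]
  simp [curl]

/-- **The apex is not backward-singular** (the profile vanishes). -/
theorem not_isBackwardSingularPoint_of_farConed (hv : InDoorClass C v) (hsign : SignE3 v) {K : ℝ} (hK : 0 ≤ K)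
    {R₀ : ℝ} (hR₀ : 0 ≤ R₀) (hcone : ∀ s < 0, ∀ r : ℝ, R₀ * Real.sqrt (-s) ≤ r → ∀ z : ℝ, tiltCirc v r z s ≤ K * vortCirc v r z s) :
    ¬ IsBackwardSingularPoint v 0 := by
  intro hsing
  have h0 := eq_zero_of_farConed hv hsign hK hR₀ hcone
  have hnorm : eLpNorm (uncurry v) ⊤
      (volume.restrict (parabolicCylinder 1 (0 : ℝ × EuclideanSpace ℝ (Fin 3)))) = 0 := by
    rw [eLpNorm_congr_ae (g := 0) ?_, eLpNorm_zero]
    filter_upwards [ae_restrict_mem (isOpen_parabolicCylinder _ _).measurableSet] with q hq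
    have hq0 : q.1 < 0 := by
      rw [mem_parabolicCylinder] at hq
      simpa using hq.1.2
    exact h0 q.1 hq0 q.2
  have htop := hsing 1 one_pos
  rw [hnorm] at htop
  exact ENNReal.zero_ne_top htop

/-- **TUBE-CONE COROLLARY**: the POINTWISE cone `‖ω_h‖ ≤ Kω₃` assumed only OUTSIDE the parabolic tube `{cylRadius x < R₀√(−s)}` about one
axis (nothing inside) forces `v ≡ 0`. -/
theorem eq_zero_of_tubeConed (hv : InDoorClass C v) (hsign : SignE3 v) {K : ℝ} (hK : 0 ≤ K) {R₀ : ℝ} (hR₀ : 0 ≤ R₀)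
    (hcone : ∀ s < 0, ∀ x, R₀ * Real.sqrt (-s) ≤ cylRadius x →
      Real.sqrt ((curl (v s) x 0) ^ 2 + (curl (v s) x 1) ^ 2) ≤ K * curl (v s) x 2) :
    ∀ t < 0, ∀ x, v t x = 0 := by
  refine eq_zero_of_farConed hv hsign hK hR₀ fun s hs r hr z => ?_
  -- pointwise cone on the circle of radius `r ≥ R₀√(−s)` ⇒ circle cone
  have hv1 := contDiff_one_slice hv hs
  have hr0 : 0 ≤ r := le_trans (by positivity) hr
  have hωc : Continuous fun θ => curl (v s) (cylPt r θ z) := by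
    have hD : Continuous (fderiv ℝ (v s)) := hv1.continuous_fderiv one_ne_zero
    have e : curl (v s) = fun x => curlCLM (fderiv ℝ (v s) x) := by funext x; exact curl_eq_curlCLM (v s) x
    rw [e]
    exact (curlCLM.continuous.comp hD).comp
      (Summit.NavierStokesRegularity.NavierStokesRegularity.Theorems.AxisTwistDoorAveragedConeLiouvilleCylFrame.continuous_cylPt_θ r z)
  have hrad : ∀ θ, cylRadius (cylPt r θ z) = r := fun θ => by
    rw [cylRadius]
    have : (cylPt r θ z) 0 ^ 2 + (cylPt r θ z) 1 ^ 2 = r ^ 2 := by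
      simp [cylPt]; nlinarith [Real.cos_sq_add_sin_sq θ]
    rw [this, Real.sqrt_sq hr0]
  unfold tiltCirc vortCirc
  rw [← intervalIntegral.integral_const_mul]
  refine intervalIntegral.integral_mono_on (by positivity) ?_ ?_ fun θ _ => ?_
  · exact (((Summit.NavierStokesRegularity.NavierStokesRegularity.Theorems.AxisTwistDoorAveragedConeLiouvilleCylFrame.continuous_horizontal.comp
      hωc).norm).mul continuous_const).intervalIntegrable _ _
  · exact (((hωc.inner continuous_const).mul continuous_const).const_mul K).intervalIntegrable _ _
  · rw [HalfSpaceWindowDoorCirculationCarryingRigidityConeFluxSubsolution.norm_horizontalPart, inner_e3]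
    have h := hcone s hs (cylPt r θ z) (by rw [hrad]; exact hr)
    have := mul_le_mul_of_nonneg_right h hr0
    linarith

/-- **CENSUS READING (enemy form).**  A circulation-carrying (`⟪curl v(σ)(y), e₃⟫ > 0` somewhere) closed-hemisphere door-class profile
VIOLATES EVERY FAR-FIELD CIRCLE CONE about the axis: for all `K ≥ 0`, `R₀ ≥ 0` there are `s < 0`, `r ≥ R₀√(−s)` and `z` with
`∮_{S(r,z)}|ω_h| dl > K ∮_{S(r,z)} ω₃ dl` (by translation covariance of the class the same holds about every vertical axis). -/
theorem enemy_farCone_fails (hv : InDoorClass C v) (hsign : SignE3 v) (hpos : ∃ σ < 0, ∃ y, 0 < ⟪curl (v σ) y, e3⟫)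
    {K : ℝ} (hK : 0 ≤ K) {R₀ : ℝ} (hR₀ : 0 ≤ R₀) :
    ∃ s < 0, ∃ r : ℝ, R₀ * Real.sqrt (-s) ≤ r ∧ ∃ z : ℝ, K * vortCirc v r z s < tiltCirc v r z s := by
  by_contra h
  push Not at h
  obtain ⟨σ, hσ, y, hy⟩ := hpos
  have h0 := eq_zero_of_farConed hv hsign hK hR₀ (fun s hs r hr z => h s hs r hr z) σ hσ
  have hslice : v σ = fun _ => 0 := funext fun x => h0 x
  have : ⟪curl (v σ) y, e3⟫ = 0 := by rw [inner_e3_apply, hslice]; simp [curl]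
  exact hy.ne' this

end Summit.NavierStokesRegularity.NavierStokesRegularity.Theorems.HalfSpaceWindowDoorCirculationCarryingRigidityFarConeLiouville

end
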